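import Mathlib.NumberTheory.NumberField.ClassNumber
import Mathlib.NumberTheory.NumberField.Discriminant.Defs
import Literature.NumberTheory.EllipticCurves.ManinConstantClassCertificate
import Literature.NumberTheory.EllipticCurves.BSDInvariants
import Literature.NumberTheory.EllipticCurves.Selmer
import Literature.NumberTheory.EllipticCurves.QuadraticTwist
import HarnessLib

/-!
# Lecouturier–Wang: a mod-`p` BSD criterion for REAL quadratic twists of the `p`-Eisenstein
# quotient of `J₀(N)` — class number and fundamental unit (Thm 1.3, Thm 1.7, Cor 1.4, Cor 1.8),
# typed for the elliptic Eisenstein quotient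

Topic `NumberTheory/EllipticCurves`; namespace `Literature.NumberTheory.EllipticCurves.LecouturierWang2023`.
ONE named fact (`def … : Prop`, D-0014, nothing asserted) — `cor_1_8_elliptic` — plus two definitions with
bodies (`eisensteinCoeff`, the `q`-expansion coefficients of Mazur's weight-two Eisenstein series `E₂` of
prime level; `UnitCriterion`, the printed condition "`u(K)^{h(K)}` is a `p`th power modulo any prime dividing
`N` in `K`") and PROVED bookkeeping: the elementary lemma behind the consumer's form of the criterion
(`exists_eq_pow_of_pow_eq_pow_of_coprime`, `not_unitCriterion_of_not_dvd_classNumber`: if `p ∤ h(K)` and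
some unit is not a `p`th power modulo a prime over `N`, the criterion FAILS) and the two corollaries a BSD
consumer wants (`cor_1_8_elliptic.of_not_unitCriterion`: `p` divides the numerator of `L(E_D,1)/Ω_D`
EXACTLY once and `Sel_p(E_D/ℚ) = 0`; `cor_1_8_elliptic.entireLFunction_one_ne_zero`: `L(E_D,1) ≠ 0`).
Written by a literature-prover seat for the cite item wi-77386 of route
`route-BirchSwinnertonDyer-RealTwistEisenstein` (crux `RealTwistEisensteinCriterion`,
stmt-BirchSwinnertonDyer-20219, "BC5 first rung": the prime-level, `p ≥ 5` theorem of print).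
HONEST FRAMING: a published theorem, cite-tagged and NOT proved here; the route's extension to squarefree
level / `p = 3` is the ROUTE's bet, not print, and is not typed.

## Source (text of record)

E. Lecouturier, J. Wang, *On the arithmetic of special values of `L`-functions for certain abelian varieties
with a rational isogeny*, arXiv:2305.00643 (2023) = Adv. Math. (2026), art. 110919,
doi:10.1016/j.aim.2026.110919 [LecouturierWang2023]. Read first-hand in the held arXiv text
`lit read paper:arxiv-2305.00643` (27 chunks; locators `pNNNN:Lnn` below are chunk:line of that key; the
theorem NUMBERS are the paper's).

* STANDING (§1 p0003:L3–L20, §2 p0007:L3–L11): "Let `N` and `p` be primes `≥ 5` such that `p ∣ N − 1` …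
  we will assume that `p² ∤ N − 1`" ("`p ∣∣ N−1` (`gcd(N−1,p²) = p`)"); `𝕋⁰` the cuspidal Hecke algebra on
  `S₂(Γ₀(N))`, `I` Mazur's Eisenstein ideal, `𝔓 = (I, p)`; `S₂^{Eis}(N,p)` = the eigenforms `f` with
  `f ≡ E₂ (mod 𝔭)` for a prime `𝔭 ∣ p` of the Hecke field, where (p0003:L7–L9)
  `E₂ = (N−1)/24 + ∑_{n ≥ 1} (∑_{d ∣ n, gcd(d,N)=1} d) qⁿ`; the `p`-EISENSTEIN QUOTIENT
  `J̃^{(p)} := J₀(N)/γ_𝔓·J₀(N)`, `γ_𝔓 = Ker(𝕋⁰ → 𝕋⁰_𝔓)`, `dim J̃^{(p)} = #S₂^{Eis}(N,p)` (p0003:L22–L30);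
  "fix a quadratic field `K` with discriminant `D` … `h(K)` the class number … `J̃^{(p)}_D` the quadratic
  twist of `J̃^{(p)}` corresponding to `K`" (p0003:L32–L34); §2: "a real quadratic field `K` of discriminant
  `D > 0` such that `gcd(D, Np) = 1` … `u(K)` and `h(K)` a fundamental unit and the class number … We assume
  that `N` splits in `K`."
* HYPOTHESIS (H) (p0003:L45–L52): `#S₂^{Eis}(N,p) = g_p := rk_{ℤ_p} 𝕋⁰_𝔓`; "the set of triples `(N,p,g_p)`
  with `p ≥ 5`, `p ∣∣ N−1` and `N ≤ 14251` such that Hypothesis (H) holds is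
  `{(11,5,1), (31,5,2), (211,5,2), (1871,5,2), (4621,5,2), (9931,5,2)}` … the simplest example … is `N = 11`
  and `p = 5`, in which case `J̃^{(p)}` is the elliptic curve `X₀(11)`."
* `L(J̃^{(p)}_D, s)` and `Ω_D > 0` = "its real Néron period" (p0003:L53; §3 p0008:L3: `Ω_A = ∫_{A(ℝ)} |ω_A|`
  for a Néron differential `ω_A`).
* THEOREM 1.3 (p0004:L7–L8): "Assume `D > 0`, `N` splits in `K` and `p ∤ D`. Then we have
  `Λ(U_𝔓, χ_D) ∈ I · H₁(X₀(N), ℤ)⁺_𝔓`. Furthermore, we have `Λ(U_𝔓, χ_D) ∈ I² · H₁(X₀(N), ℤ)^±_𝔓` if and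
  only if the Mordell–Weil rank of `J̃^{(p)}_D` is `> 0` or the completion at `𝔓` of the Tate–Shafarevich
  group of `J̃^{(p)}_D` is non-trivial."
* COROLLARY 1.4 (p0004:L12–L13): "Assume Hypothesis (H). Assume `D > 0`, `N` splits in `K` and `p ∤ D`.
  Then `p` divides the numerator of `L(J̃^{(p)}_D,1)/Ω_D`. Furthermore, `p²` divides the numerator of
  `L(J̃^{(p)}_D,1)/Ω_D` if and only if the Mordell–Weil rank of `J̃^{(p)}_D` is `> 0` or the `p`-part of the
  Tate–Shafarevich group of `J̃^{(p)}_D` is non-trivial."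
* THEOREM 1.7 (p0004:L53–L60): "Assume `D > 0`, `N` splits in `K` and `p ∤ D`. Let `u(K)` be a fundamental
  unit in `𝒪_K^×`. Then we have `Λ(U_𝔓, χ_D) ∈ I · H₁(X₀(N), ℤ)⁺_𝔓`, and the following assertions are
  equivalent: • `Λ(U_𝔓, χ_D) ∈ I² · H₁(X₀(N), ℤ)⁺_𝔓`. • `u(K)^{h(K)}` is a `p`th power modulo any prime
  dividing `N` in `K`. • `Sel_p(J̃^{(p)}_D/ℚ)_𝔓 ≠ 0`."
* COROLLARY 1.8 (p0005:L1–L8): "Assume Hypothesis (H). Assume `D > 0`, `N` splits in `K` and `p ∤ D`. Let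
  `u(K)` be a fundamental unit in `𝒪_K^×`. Then `p` divides the numerator of `L(J̃^{(p)}_D,1)/Ω_D`, and the
  following assertions are equivalent: • `p²` divides the numerator of `L(J̃^{(p)}_D,1)/Ω_D`.
  • `u(K)^{h(K)}` is a `p`th power modulo any prime dividing `N` in `K`. • `Sel_p(J̃^{(p)}_D/ℚ) ≠ 0`."
* PROPOSITION 4.1 (p0010:L52–L55): "Assume Hypothesis (H). Then the `p`-adic valuation of the rational number
  `L(J̃^{(p)}_D,1)/Ω_D` is the largest integer `n ≥ 0` such that `Θ_D ∈ Iⁿ · H₁(X₀(N), ℤ_p)⁺`", with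
  (p0010:L57) "Proposition 4.1 shows that Corollaries 1.4 and 1.8 follow from Theorems 1.3 and 1.7";
  PROPOSITION 4.2 (p0011:L1–L2, Mazur's "trivial divisibility"); PROPOSITION 6.1 (p0014:L23–L27, the
  `K₂`/Sharifi side: "… if and only if `u(K)^{h(K)}` is a `p`th power modulo a prime above `N` in `K`");
  §8 (p0017–p0026, Props 8.13–8.15: the Selmer side via de Shalit's `N`-adic uniformisation).
* DENSITY REMARK (p0005:L33–L36): "We expect that for a positive proportion and `< 100%` of the `D`'s as in
  Theorem 1.7, we have `Sel_p(J̃^{(p)}_D/ℚ) ≠ 0` … We do not know if classical techniques from number theory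
  can yield results on this conjecture." — an EXPECTATION, not typed (conjectures are not Literature).
  (Successor pointer for the route's supply crux: arXiv:2606.16404 (2026), *Indivisibility of ray class
  groups of real quadratic fields*, proves `#{0 < Δ < X : (Δ/ℓ) = 1, p ∤ h(Δ), fundamental unit not a p-th
  power mod a prime over ℓ} ≫ √X/log X` once the set is non-empty, unconditionally for `ℓ = 2p+1` — held as
  `paper:arxiv-2606.16404`, abstract and Remark after Thm 1; NOT typed here.)

## What is typed, and the reading (clause by clause)

THE ELLIPTIC EISENSTEIN QUOTIENT. The tree has no modular abelian varieties `A_f`/`J̃^{(p)}` with their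
`𝕋⁰`-action, Néron periods and `𝔓`-completed Selmer groups, so the fact is typed in the case
`dim J̃^{(p)} = #S₂^{Eis}(N,p) = 1` — the case of the paper's "simplest example" `X₀(11)`, `p = 5` — where
everything is an ELLIPTIC CURVE statement in the tree's BSD vocabulary:
* Since `p ∣∣ N−1`, `𝕋⁰_𝔓` is a DVR (p0003:L20, p0010:L19–L21) and `S₂^{Eis}(N,p)` is ONE Galois orbit
  `{f^σ}`; `γ_𝔓 = Ann_{𝕋⁰}(f)`, so `J̃^{(p)} = J₀(N)/Ann(f)J₀(N)` is the OPTIMAL quotient `A_f` of the orbit.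
  `#S₂^{Eis}(N,p) = 1` says `f` has rational Fourier coefficients, `A_f = E_f` is the `X₀(N)`-optimal
  (strong Weil) elliptic curve of conductor `N`, and (H) holds (`g_p = [ℚ_p : ℚ_p] = 1`, as print notes for
  `(11,5,1)`). Typed: `E : WeierstrassCurve ℚ`, `[E.IsElliptic] [E.IsGloballyMinimal]`,
  `E.conductorNorm ℤ = N`, `IsOptimalModel E` (the tree's predicate "model of the `X₀(N)`-optimal curve of
  its class", `ManinConstantClassCertificate.lean`, CITED not restated), and the EISENSTEIN CONGRUENCE
  `f_E ≡ E₂ (mod p)` coefficientwise: `p ∣ aₙ(E) − ∑_{d ∣ n, gcd(d,N)=1} d` for all `n ≥ 1` (Mathlib's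
  `WeierstrassCurve.LFunction : ArithmeticFunction ℤ` gives `aₙ(E) = aₙ(f_E)`; the constant terms,
  `0` vs `(N−1)/24`, are congruent automatically as `p ∣ N−1`, `p ∤ 24`). Conversely every such `E` IS
  `J̃^{(p)}` for its `(N,p)`: `f_E ∈ S₂^{Eis}(N,p)` and the orbit is `{f_E}`.
* `K`: a real quadratic field — `[NumberField K]`, `Module.finrank ℚ K = 2`, `0 < NumberField.discr K` —
  with `D := NumberField.discr K` (the fundamental discriminant); "`p ∤ D`": `¬ (p : ℤ) ∣ D`; "`N` splits in
  `K`": `((Ideal.span {(N : ℤ)}).primesOver (𝓞 K)).ncard = 2` (for prime `N` this is the tree's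
  `SatisfiesHeegnerHypothesis N K`, `HeegnerPoints.lean`); `h(K) = NumberField.classNumber K`.
* "`u(K)^{h(K)}` is a `p`th power modulo any prime dividing `N` in `K`": typed WITHOUT choosing a
  fundamental unit as `UnitCriterion K N p := ∀ 𝔫` over `N`, `∀ u ∈ 𝒪_K^×`, `u^{h(K)} mod 𝔫` is a `p`th power
  in `𝒪_K/𝔫` — EQUIVALENT to print: every unit of the real quadratic `K` is `±u(K)^k`, and `−1 = (−1)^p`
  (`p` odd); "any prime" = both primes `𝔫, 𝔫̄` (they are conjugate and `ū = ±u⁻¹`; Prop 6.1 p0014:L27 words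
  it "modulo a prime above `N`").
* `J̃^{(p)}_D`: the quadratic twist of `E` by `K` — a globally minimal model `ED` of
  `E.quadraticTwist (D : ℚ)` (`∃ C, C • ED = E.quadraticTwist D`; tree `QuadraticTwist.lean`);
  `L(J̃^{(p)}_D, 1) = ED.entireLFunction 1` (`AnalyticRank.lean`); `Ω_D = ∫_{E_D(ℝ)} |ω|` for a Néron
  differential = `ED.realPeriodRat` (`BSDInvariants.lean`: the invariant differential of a globally minimal
  model is a Néron differential; components included, as in print's `∫_{A(ℝ)}`).
* "`p` (resp. `p²`) divides the numerator of the rational number `L(J̃^{(p)}_D,1)/Ω_D`" (rationality is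
  part of print: Prop 4.1 "the rational number"): `∃ r : ℚ` with `L(E_D,1) = r · Ω_D` and `(p : ℤ) ∣ r.num`
  (resp. `(p : ℤ)^2 ∣ r.num`) — literally the numerator (`Rat.num`; for `r = 0` both hold, matching
  `v_p(0) = ∞`).
* "`Sel_p(J̃^{(p)}_D/ℚ) ≠ 0`": `ED.selmerGroup (p : ℤ) ≠ ⊥` (tree `Selmer.lean`, the `p`-Selmer group in
  `H¹(ℚ, E_D[p])`); in dimension one `𝕋⁰` acts on `J̃^{(p)}` through `ℤ`, so the `𝔓`-completion of the
  (`p`-torsion) Selmer group of Thm 1.7 (iii) is the Selmer group itself = Cor 1.8's third bullet.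
* Thm 1.3 / Thm 1.7 (the homological statements `Λ(U_𝔓,χ_D) ∈ Iⁿ·H₁(X₀(N),ℤ)⁺_𝔓`) are, under (H), turned
  into Cor 1.4 / Cor 1.8 by Prop 4.1 (print, p0010:L57); in the typed case (H) holds, so `cor_1_8_elliptic`
  carries the full content of Thm 1.3 (first assertion) + Thm 1.7 + Cor 1.8 for the elliptic quotient.

DELTA TO PRINT (WEAKER than print, never stronger): (1) special case `dim J̃^{(p)} = 1`;
`-- TODO(general form): the p-Eisenstein quotient of dimension g = #S₂^{Eis}(N,p) > 1 (needs optimal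
quotients A_f of J₀(N) with 𝕋⁰-action, quadratic twists of abelian varieties, Néron periods ∫_{A(ℝ)}|ω_A|,
and 𝔓-completed p-Selmer groups; then Thm 1.7 verbatim and Cor 1.8 under (H))`; (2) the homological
form of Thm 1.3/1.7 (`Iⁿ·H₁(X₀(N),ℤ)⁺_𝔓`) is not typed separately (no `𝔓`-adic Hecke-module completion of
`H₁` in the tree); (3) Thm 1.1/1.5, Cor 1.2/1.6 (Mazur 1979, IMAGINARY `K`) are not typed (not asked).
PUBLISHED: Adv. Math. 2026 (the held text is the arXiv version; statements quoted from it).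

## References
* [LecouturierWang2023] E. Lecouturier, J. Wang, arXiv:2305.00643 = Adv. Math. (2026) art. 110919: Thm 1.3,
  Cor 1.4 (p0004), Thm 1.7 (p0004:L53–L60), Cor 1.8 (p0005:L1–L8), Prop 4.1–4.2 (p0010–p0011), Prop 6.1
  (p0014), §8 (p0017–p0026).
* B. Mazur, *Modular curves and the Eisenstein ideal*, Publ. Math. IHÉS 47 (1977) (the quotient `J̃^{(p)}`,
  `𝕋⁰/I`, `𝕋⁰_𝔓` a DVR when `p ∣∣ N−1`). [Mazur1977]
* B. Mazur, *On the arithmetic of special values of L functions*, Invent. Math. 55 (1979) (Thm 1.1/1.5,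
  the odd-twist analogue). [Mazur1979]
-/

noncomputable section

open NumberField WeierstrassCurve Literature.NumberTheory.EllipticCurves.ModularForms

namespace Literature.NumberTheory.EllipticCurves.LecouturierWang2023

/-! ### The two definitions -/

-- PROVED (definition)
/-- The `n`-th Fourier coefficient (`n ≥ 1`) of Mazur's weight-two Eisenstein series of prime level `N`,
`E₂ = (N−1)/24 + ∑_{n ≥ 1} (∑_{d ∣ n, gcd(d,N)=1} d) qⁿ` ("the unique Eisenstein series of weight `2` and
level `Γ₀(N)`"): `∑_{d ∣ n, gcd(d,N) = 1} d`. (For `n = 0` the junk value `0`; the constant term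
`(N−1)/24` is not used.) [cite: LecouturierWang2023, §1 (display after (1), arXiv text p0003:L7–L9)] -/
def eisensteinCoeff (N n : ℕ) : ℕ :=
  ∑ d ∈ n.divisors with Nat.Coprime d N, d

/-- Unfolding of `eisensteinCoeff`. [cite: LecouturierWang2023, §1 (p0003:L7–L9)] -/
theorem eisensteinCoeff_def (N n : ℕ) :
    eisensteinCoeff N n = ∑ d ∈ n.divisors with Nat.Coprime d N, d := rfl

/-- `a₁(E₂) = 1`. [cite: LecouturierWang2023, §1 (p0003:L7–L9)] -/
theorem eisensteinCoeff_one (N : ℕ) : eisensteinCoeff N 1 = 1 := by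
  simp [eisensteinCoeff, Finset.filter_singleton]

/-- For a prime `ℓ` coprime to `N`, `a_ℓ(E₂) = ℓ + 1` (so the Eisenstein congruence
at `ℓ` reads `a_ℓ(f) ≡ ℓ + 1 (mod p)`, Mazur's `T_ℓ − ℓ − 1 ∈ I`). [cite: LecouturierWang2023, §1 (p0003:L7–L14)] -/
theorem eisensteinCoeff_prime {N ℓ : ℕ} (hℓ : ℓ.Prime) (hℓN : Nat.Coprime ℓ N) :
    eisensteinCoeff N ℓ = ℓ + 1 := by
  rw [eisensteinCoeff, hℓ.divisors]
  have h1 : Nat.Coprime 1 N := Nat.coprime_one_left N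
  rw [Finset.filter_true_of_mem (fun d hd ↦ by
    simp only [Finset.mem_insert, Finset.mem_singleton] at hd
    rcases hd with rfl | rfl <;> assumption)]
  rw [Finset.sum_pair hℓ.one_lt.ne, add_comm]

/-- At the level itself, `a_N(E₂) = 1` for prime `N` (only `d = 1` is prime to `N`; Mazur's `U_N − 1 ∈ I`).
[cite: LecouturierWang2023, §1 (p0003:L7–L14)] -/
theorem eisensteinCoeff_level {N : ℕ} (hN : N.Prime) : eisensteinCoeff N N = 1 := by
  rw [eisensteinCoeff, hN.divisors]
  have : ({1, N} : Finset ℕ).filter (fun d ↦ Nat.Coprime d N) = {1} := by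
    ext d
    simp only [Finset.mem_filter, Finset.mem_insert, Finset.mem_singleton]
    constructor
    · rintro ⟨rfl | rfl, h⟩
      · rfl
      · exact absurd ((Nat.coprime_self _).mp h) hN.one_lt.ne'
    · rintro rfl
      exact ⟨Or.inl rfl, Nat.coprime_one_left N⟩
  rw [this, Finset.sum_singleton]

-- PROVED (definition)
/-- **The unit/class-number criterion of Thm 1.7 (ii) / Cor 1.8 (ii)**: "`u(K)^{h(K)}` is a `p`th power
modulo any prime dividing `N` in `K`" (`u(K)` a fundamental unit, `h(K)` the class number), typed without
choosing a fundamental unit: for EVERY prime `𝔫` of `𝒪_K` over `N` and EVERY unit `u ∈ 𝒪_K^×`, the class of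
`u^{h(K)}` in `𝒪_K/𝔫` is a `p`-th power. Equivalent to print for a real quadratic `K` and odd `p`: every
unit is `±u(K)^k` and `−1 = (−1)^p`; the two primes over a split `N` are conjugate (Prop 6.1 says "modulo a
prime above `N`"). [cite: LecouturierWang2023, Thm 1.7 (ii) and Cor 1.8 (ii) (arXiv text p0004:L58, p0005:L6); Prop 6.1 (p0014:L23–L27)] -/
def UnitCriterion (K : Type*) [Field K] [NumberField K] (N p : ℕ) : Prop :=
  ∀ 𝔫 ∈ (Ideal.span {(N : ℤ)}).primesOver (𝓞 K), ∀ u : (𝓞 K)ˣ,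
    ∃ v : 𝓞 K ⧸ 𝔫, Ideal.Quotient.mk 𝔫 ((u : 𝓞 K) ^ classNumber K) = v ^ p

/-- Unfolding of `UnitCriterion`. [cite: LecouturierWang2023, Thm 1.7 (ii)] -/
theorem unitCriterion_iff (K : Type*) [Field K] [NumberField K] (N p : ℕ) :
    UnitCriterion K N p ↔ ∀ 𝔫 ∈ (Ideal.span {(N : ℤ)}).primesOver (𝓞 K), ∀ u : (𝓞 K)ˣ,
      ∃ v : 𝓞 K ⧸ 𝔫, Ideal.Quotient.mk 𝔫 ((u : 𝓞 K) ^ classNumber K) = v ^ p :=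
  Iff.rfl

/-! ### Elementary bookkeeping: `p ∤ h(K)` and a non-`p`th-power unit make the criterion fail -/

/-- In a commutative ring, a UNIT `x` with `x ^ h = v ^ p` and `gcd(h, p) = 1` (`p > 1`) is itself a `p`-th
power: with `h·m = p·q + 1` (Bézout) and `x·y = 1`, `x = x^{hm} y^{pq} = (v^m y^q)^p`. [folklore] -/
private theorem exists_eq_pow_of_pow_eq_pow_of_coprime {R : Type*} [CommRing R] {x v : R} (hx : IsUnit x)
    {h p : ℕ} (hp : 1 < p) (hcop : Nat.Coprime h p) (hv : x ^ h = v ^ p) : ∃ w : R, x = w ^ p := by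
  obtain ⟨m, -, hm⟩ := Nat.exists_mul_mod_eq_one_of_coprime hcop hp
  obtain ⟨y, hy⟩ := hx.exists_right_inv
  obtain ⟨q, hq⟩ : ∃ q, h * m = p * q + 1 :=
    ⟨h * m / p, by have := Nat.div_add_mod (h * m) p; omega⟩
  refine ⟨v ^ m * y ^ q, ?_⟩
  have h1 : x ^ (h * m) * y ^ (p * q) = x := by
    rw [hq, pow_succ, mul_assoc, mul_comm x (y ^ (p * q)), ← mul_assoc, ← mul_pow, hy, one_pow,
      one_mul]
  calc x = x ^ (h * m) * y ^ (p * q) := h1.symm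
    _ = (v ^ m * y ^ q) ^ p := by
        rw [pow_mul, hv, ← pow_mul, mul_pow, ← pow_mul, ← pow_mul, mul_comm m p, mul_comm q p]

/-- **The consumer's form of "NOT (ii)".** If `p` is a prime not dividing `h(K)` and some unit `u ∈ 𝒪_K^×` is
not a `p`-th power modulo some prime `𝔫` of `𝒪_K` over `N`, then the criterion `UnitCriterion K N p` FAILS
(were `u^{h(K)}` a `p`-th power mod `𝔫`, so would be `u`, by `exists_eq_pow_of_pow_eq_pow_of_coprime`). This is
the hypothesis shape of the route crux `RealTwistEisensteinCriterion` ("`p ∤ h(F)` and a unit that is not a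
`p`-th power modulo some prime over `ℓ`"). [cite: LecouturierWang2023, Thm 1.7 (ii) / Cor 1.8 (the criterion negated)] -/
theorem not_unitCriterion_of_not_dvd_classNumber {K : Type*} [Field K] [NumberField K] {N p : ℕ}
    (hp : p.Prime) (hh : ¬ p ∣ classNumber K) {𝔫 : Ideal (𝓞 K)}
    (h𝔫 : 𝔫 ∈ (Ideal.span {(N : ℤ)}).primesOver (𝓞 K)) (u : (𝓞 K)ˣ)
    (hu : ∀ v : 𝓞 K ⧸ 𝔫, Ideal.Quotient.mk 𝔫 (u : 𝓞 K) ≠ v ^ p) : ¬ UnitCriterion K N p := by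
  intro hcrit
  obtain ⟨v, hv⟩ := hcrit 𝔫 h𝔫 u
  rw [map_pow] at hv
  have hx : IsUnit (Ideal.Quotient.mk 𝔫 (u : 𝓞 K)) := (Units.isUnit u).map _
  have hcop : Nat.Coprime (classNumber K) p :=
    Nat.Coprime.symm ((Nat.Prime.coprime_iff_not_dvd hp).mpr hh)
  obtain ⟨w, hw⟩ := exists_eq_pow_of_pow_eq_pow_of_coprime hx hp.one_lt hcop hv
  exact hu w hw

/-! ### The named fact: Cor 1.8 (with Thm 1.3's first assertion and Thm 1.7) for the elliptic quotient -/

-- FACT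
/-- **Lecouturier–Wang, Cor 1.8 (⊇ Thm 1.3 first assertion, Thm 1.7, Cor 1.4 via Prop 4.1), for the
ELLIPTIC `p`-Eisenstein quotient.** Print (arXiv text p0005:L1–L8): "Assume Hypothesis (H). Assume `D > 0`,
`N` splits in `K` and `p ∤ D`. Let `u(K)` be a fundamental unit in `𝒪_K^×`. Then `p` divides the numerator of
`L(J̃^{(p)}_D,1)/Ω_D`, and the following assertions are equivalent: • `p²` divides the numerator of
`L(J̃^{(p)}_D,1)/Ω_D`. • `u(K)^{h(K)}` is a `p`th power modulo any prime dividing `N` in `K`.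
• `Sel_p(J̃^{(p)}_D/ℚ) ≠ 0`." Standing: `N, p` primes `≥ 5`, `p ∣∣ N − 1`; `J̃^{(p)}` Mazur's `p`-Eisenstein
quotient of `J₀(N)`, `J̃^{(p)}_D` its twist by the real quadratic `K` of discriminant `D`, `Ω_D` its real
Néron period `∫ |ω|`. TYPED IN THE CASE `dim J̃^{(p)} = 1` (then (H) holds and `J̃^{(p)}` is the
`X₀(N)`-optimal elliptic curve `E` of conductor `N` whose newform is `≡ E₂ (mod p)`; e.g. `X₀(11)`, `p = 5`,
print's "simplest example", p0003:L50–L52): for such `E` (`IsOptimalModel E`, globally minimal,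
`E.conductorNorm ℤ = N`, `p ∣ aₙ(E) − aₙ(E₂)` for all `n ≥ 1`), every real quadratic `K` (`finrank 2`,
`discr K = D > 0`) with `p ∤ D` in which `N` splits, and every globally minimal model `ED` of the twist
`E^{(D)}`: there is `r ∈ ℚ` with `L(E_D, 1) = r · Ω(E_D)` (`entireLFunction 1`, `realPeriodRat`) such that
`p ∣ num r`, and [`p² ∣ num r` ⟺ `UnitCriterion K N p`] and [`UnitCriterion K N p` ⟺ `Sel_p(E_D/ℚ) ≠ 0`]
(`selmerGroup p ≠ ⊥`). WEAKER than print (special case; see the module docstring for the clause-by-clause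
reading and `-- TODO(general form)`).
[cite: LecouturierWang2023, Cor 1.8 (arXiv:2305.00643 text p0005:L1–L8); Thm 1.7 (p0004:L53–L60); Thm 1.3 (p0004:L7–L8); Prop 4.1 (p0010:L52–L57); Hyp (H) and the X₀(11) example (p0003:L45–L52)] -/
def cor_1_8_elliptic : Prop :=
  ∀ (N p : ℕ), N.Prime → p.Prime → 5 ≤ N → 5 ≤ p → p ∣ N - 1 → ¬ p ^ 2 ∣ N - 1 →
  ∀ (E : WeierstrassCurve ℚ) [E.IsElliptic] [E.IsGloballyMinimal],
    E.conductorNorm ℤ = N → IsOptimalModel E →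
    (∀ n : ℕ, 1 ≤ n → (p : ℤ) ∣ E.LFunction n - (eisensteinCoeff N n : ℤ)) →
  ∀ (K : Type) [Field K] [NumberField K],
    Module.finrank ℚ K = 2 → 0 < NumberField.discr K → ¬ (p : ℤ) ∣ NumberField.discr K →
    ((Ideal.span {(N : ℤ)}).primesOver (𝓞 K)).ncard = 2 →
  ∀ (ED : WeierstrassCurve ℚ) [ED.IsElliptic] [ED.IsGloballyMinimal],
    (∃ C : WeierstrassCurve.VariableChange ℚ, C • ED = E.quadraticTwist (NumberField.discr K : ℚ)) →
    ∃ r : ℚ, ED.entireLFunction 1 = (((r : ℝ) * ED.realPeriodRat : ℝ) : ℂ) ∧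
      (p : ℤ) ∣ r.num ∧
      ((p : ℤ) ^ 2 ∣ r.num ↔ UnitCriterion K N p) ∧
      (UnitCriterion K N p ↔ ED.selmerGroup (p : ℤ) ≠ ⊥)

-- TODO(general form): the `p`-Eisenstein quotient `J̃^{(p)}` of dimension `g = #S₂^{Eis}(N,p) > 1`
-- (optimal quotients `A_f` of `J₀(N)` with `𝕋⁰`-action, their quadratic twists, Néron periods and
-- `𝔓`-completed `p`-Selmer groups): Thm 1.7 verbatim, Cor 1.8 under Hypothesis (H).

/-! ### Proved corollaries in the consumer's currency -/

/-- **Cor 1.8 read through "NOT (ii)"**: under the hypotheses of `cor_1_8_elliptic`, if `p ∤ h(K)` and some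
unit of `𝒪_K` is not a `p`-th power modulo some prime over `N`, then `p` divides the numerator of
`L(E_D,1)/Ω(E_D)` EXACTLY ONCE (`p ∣ num r`, `p² ∤ num r`) and `Sel_p(E_D/ℚ) = 0`. Pure logic from the fact
and `not_unitCriterion_of_not_dvd_classNumber`. [cite: LecouturierWang2023, Cor 1.8 (p0005:L1–L8)] -/
theorem cor_1_8_elliptic.of_not_unitCriterion (H : cor_1_8_elliptic)
    {N p : ℕ} (hN : N.Prime) (hp : p.Prime) (hN5 : 5 ≤ N) (hp5 : 5 ≤ p) (hpN : p ∣ N - 1)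
    (hpN2 : ¬ p ^ 2 ∣ N - 1)
    (E : WeierstrassCurve ℚ) [E.IsElliptic] [E.IsGloballyMinimal] (hcond : E.conductorNorm ℤ = N)
    (hopt : IsOptimalModel E) (hEis : ∀ n : ℕ, 1 ≤ n → (p : ℤ) ∣ E.LFunction n - (eisensteinCoeff N n : ℤ))
    (K : Type) [Field K] [NumberField K] (hK2 : Module.finrank ℚ K = 2) (hD : 0 < NumberField.discr K)
    (hpD : ¬ (p : ℤ) ∣ NumberField.discr K) (hsplit : ((Ideal.span {(N : ℤ)}).primesOver (𝓞 K)).ncard = 2)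
    (ED : WeierstrassCurve ℚ) [ED.IsElliptic] [ED.IsGloballyMinimal]
    (hED : ∃ C : WeierstrassCurve.VariableChange ℚ, C • ED = E.quadraticTwist (NumberField.discr K : ℚ))
    (hh : ¬ p ∣ classNumber K)
    (hu : ∃ 𝔫 ∈ (Ideal.span {(N : ℤ)}).primesOver (𝓞 K), ∃ u : (𝓞 K)ˣ,
      ∀ v : 𝓞 K ⧸ 𝔫, Ideal.Quotient.mk 𝔫 (u : 𝓞 K) ≠ v ^ p) :
    ∃ r : ℚ, ED.entireLFunction 1 = (((r : ℝ) * ED.realPeriodRat : ℝ) : ℂ) ∧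
      (p : ℤ) ∣ r.num ∧ ¬ (p : ℤ) ^ 2 ∣ r.num ∧ ED.selmerGroup (p : ℤ) = ⊥ := by
  obtain ⟨𝔫, h𝔫, u, hu⟩ := hu
  have hnot : ¬ UnitCriterion K N p := not_unitCriterion_of_not_dvd_classNumber hp hh h𝔫 u hu
  obtain ⟨r, hr, hp1, hp2, hsel⟩ :=
    H N p hN hp hN5 hp5 hpN hpN2 E hcond hopt hEis K hK2 hD hpD hsplit ED hED
  refine ⟨r, hr, hp1, fun h2 ↦ hnot (hp2.mp h2), ?_⟩
  by_contra hne
  exact hnot (hsel.mpr hne)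

/-- **Non-vanishing of the twisted central value**: under the hypotheses of
`cor_1_8_elliptic.of_not_unitCriterion`, `L(E_D, 1) ≠ 0` — because `p² ∤ num r` forces `r ≠ 0`, and
`Ω(E_D) > 0` (`WeierstrassCurve.realPeriod_pos'`, `RealPeriod.lean`). This is the "`L(W^{(D)},1) ≠ 0`"
half of what the route crux `RealTwistEisensteinCriterion` asks of the criterion at prime level, `p ≥ 5`.
[cite: LecouturierWang2023, Cor 1.8 (p0005:L1–L8)] -/
theorem cor_1_8_elliptic.entireLFunction_one_ne_zero (H : cor_1_8_elliptic)
    {N p : ℕ} (hN : N.Prime) (hp : p.Prime) (hN5 : 5 ≤ N) (hp5 : 5 ≤ p) (hpN : p ∣ N - 1)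
    (hpN2 : ¬ p ^ 2 ∣ N - 1)
    (E : WeierstrassCurve ℚ) [E.IsElliptic] [E.IsGloballyMinimal] (hcond : E.conductorNorm ℤ = N)
    (hopt : IsOptimalModel E) (hEis : ∀ n : ℕ, 1 ≤ n → (p : ℤ) ∣ E.LFunction n - (eisensteinCoeff N n : ℤ))
    (K : Type) [Field K] [NumberField K] (hK2 : Module.finrank ℚ K = 2) (hD : 0 < NumberField.discr K)
    (hpD : ¬ (p : ℤ) ∣ NumberField.discr K) (hsplit : ((Ideal.span {(N : ℤ)}).primesOver (𝓞 K)).ncard = 2)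
    (ED : WeierstrassCurve ℚ) [ED.IsElliptic] [ED.IsGloballyMinimal]
    (hED : ∃ C : WeierstrassCurve.VariableChange ℚ, C • ED = E.quadraticTwist (NumberField.discr K : ℚ))
    (hh : ¬ p ∣ classNumber K)
    (hu : ∃ 𝔫 ∈ (Ideal.span {(N : ℤ)}).primesOver (𝓞 K), ∃ u : (𝓞 K)ˣ,
      ∀ v : 𝓞 K ⧸ 𝔫, Ideal.Quotient.mk 𝔫 (u : 𝓞 K) ≠ v ^ p) :
    ED.entireLFunction 1 ≠ 0 := by
  obtain ⟨r, hr, -, hp2, -⟩ := cor_1_8_elliptic.of_not_unitCriterion H hN hp hN5 hp5 hpN hpN2 E hcond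
    hopt hEis K hK2 hD hpD hsplit ED hED hh hu
  have hr0 : r ≠ 0 := by
    rintro rfl
    exact hp2 (by simp)
  have hΩ : 0 < ED.realPeriodRat := by
    haveI : (ED.baseChange ℝ).IsElliptic := by rw [WeierstrassCurve.baseChange]; infer_instance
    exact (ED.baseChange ℝ).realPeriod_pos'
  rw [hr]
  exact_mod_cast mul_ne_zero (Rat.cast_ne_zero.mpr hr0) hΩ.ne'

end Literature.NumberTheory.EllipticCurves.LecouturierWang2023

end
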